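import Mathlib.Topology.Algebra.Group.Matrix
import Mathlib.Topology.Algebra.Order.Archimedean
import Mathlib.Analysis.SpecificLimits.Basic
import HarnessLib

/-!
# Discrete subgroups of `SL(2, ℝ)` stabilising a cusp: finite index over a parabolic element

Classical input for [AbsTopIII] Prop 4.2 (i) in the PUNCTURED (cusped) case (S. Mochizuki, *Topics in
Absolute Anabelian Geometry III*, proof of Proposition 4.2 (i), p. 106: finiteness of
`N_{PSL₂(ℝ)}(Γ̄)/Γ̄` for the uniformising Fuchsian group of a hyperbolic curve), textbook material on
Fuchsian groups (Farkas–Kra IV.5–IV.6; Shimura, *Arithmetic Theory of Automorphic Functions* §1.5: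
"the stabiliser of a cusp in a Fuchsian group is `{±1} ×` infinite cyclic").  In coordinates with the
cusp at `∞`: let `D ≤ SL(2, ℝ)` be DISCRETE and upper triangular (`d₁₀ = 0` for all `d ∈ D`) and let
`u ∈ D` be parabolic.  Then

* `sl_entry_eq_one_or_neg_one_of_upperTriangular_discrete` — every `d ∈ D` has diagonal `±1`
  (otherwise `d^k u d^{-k}` accumulates at `1`);
* `finiteIndex_zpowers_of_upperTriangular_discrete` (`u` unipotent) and
  `finiteIndex_zpowers_of_upperTriangular_discrete_of_isParabolic` — `⟨u⟩` has FINITE INDEX in `D`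
  (the translation parts form a discrete, hence cyclic, subgroup of `ℝ`: `AddSubgroup.dense_or_cyclic`).

PROOF-ONLY file (abc-iut cell, row «J2i-CUSPED», seat abc-iut-L4-d1): no definitions, no named facts;
the unipotent family `x ↦ [[1, x], [0, 1]]` is a local `let`.  HONEST FRAMING: classical, undisputed;
nothing here bears on [IUTchIII] Cor. 3.12 or asserts anything about abc.
-/

noncomputable section

open scoped MatrixGroups Topology
open Filter

namespace Literature.AnabelianGeometry.AbsoluteAnabelian.HolRS

/-- In an upper-triangular element of `SL(2, ℝ)` the diagonal entries are mutually inverse.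
[cite: FarkasKra1992, IV.5.6] -/
private theorem mul_eq_one_of_upper (g : SL(2, ℝ)) (hg : (g : Matrix (Fin 2) (Fin 2) ℝ) 1 0 = 0) :
    (g : Matrix (Fin 2) (Fin 2) ℝ) 0 0 * (g : Matrix (Fin 2) (Fin 2) ℝ) 1 1 = 1 := by
  have h := Matrix.SpecialLinearGroup.det_coe g
  rw [Matrix.det_fin_two, hg, mul_zero, sub_zero] at h
  exact h

/-- A discrete subgroup meets some open neighbourhood of `1` only in `1`. [cite: FarkasKra1992, IV.5.6] -/
private theorem exists_open_forall_eq_one {G : Type*} [Group G] [TopologicalSpace G] (D : Subgroup G)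
    [DiscreteTopology D] : ∃ W : Set G, IsOpen W ∧ (1 : G) ∈ W ∧ ∀ g ∈ D, g ∈ W → g = 1 := by
  obtain ⟨W, hWo, hWe⟩ := isOpen_induced_iff.mp (isOpen_discrete ({1} : Set D))
  refine ⟨W, hWo, ?_, fun g hg hgW => ?_⟩
  · have : (1 : D) ∈ Subtype.val ⁻¹' W := by rw [hWe]; rfl
    exact this
  · have : (⟨g, hg⟩ : D) ∈ Subtype.val ⁻¹' W := hgW
    rw [hWe, Set.mem_singleton_iff] at this
    exact congrArg Subtype.val this

section Unipotent

/-! ### The unipotent family `U x = [[1, x], [0, 1]]` (a local function, characterised by its entries) -/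

variable (U : ℝ → SL(2, ℝ)) (hU : ∀ x, (U x : Matrix (Fin 2) (Fin 2) ℝ) = !![1, x; 0, 1])
include hU

/-- `U (x + y) = U x · U y`. [cite: FarkasKra1992, IV.5.6] -/
private theorem U_add (x y : ℝ) : U (x + y) = U x * U y := by
  ext i j
  rw [Matrix.SpecialLinearGroup.coe_mul, Matrix.mul_apply, Fin.sum_univ_two, hU, hU, hU]
  fin_cases i <;> fin_cases j <;> simp [add_comm]

/-- `U 0 = 1`. [cite: FarkasKra1992, IV.5.6] -/
private theorem U_zero : U 0 = 1 := by
  ext i j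
  rw [hU, Matrix.SpecialLinearGroup.coe_one]
  fin_cases i <;> fin_cases j <;> simp

/-- `U (-x) = (U x)⁻¹`. [cite: FarkasKra1992, IV.5.6] -/
private theorem U_neg (x : ℝ) : U (-x) = (U x)⁻¹ := by
  symm
  apply inv_eq_of_mul_eq_one_right
  rw [← U_add U hU, add_neg_cancel, U_zero U hU]

/-- `U` is injective (read off the entry `(0, 1)`). [cite: FarkasKra1992, IV.5.6] -/
private theorem U_inj {x y : ℝ} (h : U x = U y) : x = y := by
  have := congrArg (fun g : SL(2, ℝ) => (g : Matrix (Fin 2) (Fin 2) ℝ) 0 1) h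
  simpa [hU] using this

/-- An upper-triangular element with entry `(0, 0)` equal to `1` is `U` of its entry `(0, 1)`.
[cite: FarkasKra1992, IV.5.6] -/
private theorem eq_U (g : SL(2, ℝ)) (h10 : (g : Matrix (Fin 2) (Fin 2) ℝ) 1 0 = 0)
    (h00 : (g : Matrix (Fin 2) (Fin 2) ℝ) 0 0 = 1) : g = U ((g : Matrix (Fin 2) (Fin 2) ℝ) 0 1) := by
  have h11 : (g : Matrix (Fin 2) (Fin 2) ℝ) 1 1 = 1 := by
    have := mul_eq_one_of_upper g h10
    rwa [h00, one_mul] at this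
  ext i j
  rw [hU]
  fin_cases i <;> fin_cases j <;> simp [h10, h00, h11]

/-- Conjugating `U x` by an upper-triangular `e` rescales `x` by the square of the diagonal entry:
`e · U x · e⁻¹ = U (e₀₀² x)`. [cite: FarkasKra1992, IV.5.6] -/
private theorem conj_U (e : SL(2, ℝ)) (he : (e : Matrix (Fin 2) (Fin 2) ℝ) 1 0 = 0) (x : ℝ) :
    e * U x * e⁻¹ = U ((e : Matrix (Fin 2) (Fin 2) ℝ) 0 0 ^ 2 * x) := by
  have hd := mul_eq_one_of_upper e he
  ext i j
  simp only [Matrix.SpecialLinearGroup.coe_mul, Matrix.SpecialLinearGroup.coe_inv,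
    Matrix.adjugate_fin_two, Matrix.mul_apply, Fin.sum_univ_two, hU]
  fin_cases i <;> fin_cases j <;> simp [he] <;> nlinarith [hd]

/-- `U` is continuous. [cite: FarkasKra1992, IV.5.6] -/
private theorem U_continuous : Continuous U := by
  have hc : Continuous fun x : ℝ => !![(1 : ℝ), x; 0, 1] := by
    refine continuous_matrix fun i j => ?_
    fin_cases i <;> fin_cases j <;> simp <;> fun_prop
  have hc' : Continuous fun x => ((U x : SL(2, ℝ)) : Matrix (Fin 2) (Fin 2) ℝ) := by
    simp_rw [hU]; exact hc
  exact Matrix.SpecialLinearGroup.isClosedEmbedding_val.isEmbedding.continuous_iff.mpr hc'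

/-- **Diagonal entries are `±1`.**  With `U` as above: in a DISCRETE upper-triangular `D ≤ SL(2, ℝ)`
containing a unipotent `u = U h`, `h ≠ 0`, every `d ∈ D` has `d₀₀ = ±1` — else, for `e ∈ {d, d⁻¹}` with
`|e₀₀| < 1`, the elements `e^k u e^{-k} = U (e₀₀^{2k} h) ∈ D ∖ {1}` converge to `1`.
[cite: FarkasKra1992, IV.5.6] -/
private theorem entry_eq_one_or_neg_one_aux (D : Subgroup SL(2, ℝ)) [DiscreteTopology D]
    (hD : ∀ d ∈ D, (d : Matrix (Fin 2) (Fin 2) ℝ) 1 0 = 0) {u : SL(2, ℝ)} (hu : u ∈ D)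
    (hu00 : (u : Matrix (Fin 2) (Fin 2) ℝ) 0 0 = 1) (hu01 : (u : Matrix (Fin 2) (Fin 2) ℝ) 0 1 ≠ 0)
    {d : SL(2, ℝ)} (hd : d ∈ D) :
    (d : Matrix (Fin 2) (Fin 2) ℝ) 0 0 = 1 ∨ (d : Matrix (Fin 2) (Fin 2) ℝ) 0 0 = -1 := by
  obtain ⟨W, hWo, h1W, hW⟩ := exists_open_forall_eq_one D
  by_contra hne
  push Not at hne
  have hdet := mul_eq_one_of_upper d (hD d hd)
  -- some `e ∈ D` with `|e₀₀| < 1`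
  obtain ⟨e, he, hlt⟩ : ∃ e ∈ D, |(e : Matrix (Fin 2) (Fin 2) ℝ) 0 0| < 1 := by
    have hne1 : |(d : Matrix (Fin 2) (Fin 2) ℝ) 0 0| ≠ 1 := fun h => by
      rcases (abs_eq zero_le_one).mp h with h | h
      exacts [hne.1 h, hne.2 h]
    rcases lt_or_gt_of_ne hne1 with h | h
    · exact ⟨d, hd, h⟩
    · refine ⟨d⁻¹, D.inv_mem hd, ?_⟩
      have h11 : (d : Matrix (Fin 2) (Fin 2) ℝ) 1 1 = ((d : Matrix (Fin 2) (Fin 2) ℝ) 0 0)⁻¹ :=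
        eq_inv_of_mul_eq_one_right hdet
      rw [Matrix.SpecialLinearGroup.coe_inv, Matrix.adjugate_fin_two]
      simp only [Matrix.of_apply, Matrix.cons_val', Matrix.cons_val_zero, Matrix.cons_val_fin_one]
      rw [h11, abs_inv]
      exact inv_lt_one_of_one_lt₀ h
  have he10 := hD e he
  have hed := mul_eq_one_of_upper e he10
  have ha0 : (e : Matrix (Fin 2) (Fin 2) ℝ) 0 0 ≠ 0 := fun h0 => by
    rw [h0, zero_mul] at hed
    exact zero_ne_one hed
  -- `U (e₀₀^{2k} h) ∈ D`
  have hu_eq : u = U ((u : Matrix (Fin 2) (Fin 2) ℝ) 0 1) := eq_U U hU u (hD u hu) hu00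
  have hmem : ∀ k : ℕ, U (((e : Matrix (Fin 2) (Fin 2) ℝ) 0 0 ^ 2) ^ k *
      (u : Matrix (Fin 2) (Fin 2) ℝ) 0 1) ∈ D := by
    intro k
    induction k with
    | zero => rw [pow_zero, one_mul, ← hu_eq]; exact hu
    | succ k ih =>
      have := D.mul_mem (D.mul_mem he ih) (D.inv_mem he)
      rw [conj_U U hU e he10] at this
      convert this using 2
      ring
  -- these converge to `U 0 = 1`
  have ht : Tendsto (fun k : ℕ => ((e : Matrix (Fin 2) (Fin 2) ℝ) 0 0 ^ 2) ^ k *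
      (u : Matrix (Fin 2) (Fin 2) ℝ) 0 1) atTop (𝓝 0) := by
    have h2 : Tendsto (fun k : ℕ => ((e : Matrix (Fin 2) (Fin 2) ℝ) 0 0 ^ 2) ^ k) atTop (𝓝 0) :=
      tendsto_pow_atTop_nhds_zero_of_lt_one (sq_nonneg _) ((sq_lt_one_iff_abs_lt_one _).mpr hlt)
    simpa using h2.mul_const ((u : Matrix (Fin 2) (Fin 2) ℝ) 0 1)
  have hUt : Tendsto (fun k : ℕ => U (((e : Matrix (Fin 2) (Fin 2) ℝ) 0 0 ^ 2) ^ k *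
      (u : Matrix (Fin 2) (Fin 2) ℝ) 0 1)) atTop (𝓝 1) := by
    have := ((U_continuous U hU).tendsto 0).comp ht
    rwa [U_zero U hU] at this
  obtain ⟨k, hk⟩ := (hUt.eventually (hWo.mem_nhds h1W)).exists
  have h1 : U (((e : Matrix (Fin 2) (Fin 2) ℝ) 0 0 ^ 2) ^ k * (u : Matrix (Fin 2) (Fin 2) ℝ) 0 1) = 1 :=
    hW _ (hmem k) hk
  have h0 : ((e : Matrix (Fin 2) (Fin 2) ℝ) 0 0 ^ 2) ^ k * (u : Matrix (Fin 2) (Fin 2) ℝ) 0 1 = 0 :=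
    U_inj U hU (h1.trans (U_zero U hU).symm)
  rcases mul_eq_zero.mp h0 with h' | h'
  · exact pow_ne_zero _ (pow_ne_zero _ ha0) h'
  · exact hu01 h'

/-- **Finite index over the unipotent** (with `U` as above).  [cite: FarkasKra1992, IV.5.6] -/
private theorem finiteIndex_zpowers_aux (D : Subgroup SL(2, ℝ)) [DiscreteTopology D]
    (hD : ∀ d ∈ D, (d : Matrix (Fin 2) (Fin 2) ℝ) 1 0 = 0) {u : SL(2, ℝ)} (hu : u ∈ D)
    (hu00 : (u : Matrix (Fin 2) (Fin 2) ℝ) 0 0 = 1) (hu01 : (u : Matrix (Fin 2) (Fin 2) ℝ) 0 1 ≠ 0) :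
    ((Subgroup.zpowers u).subgroupOf D).FiniteIndex := by
  classical
  obtain ⟨W, hWo, h1W, hW⟩ := exists_open_forall_eq_one D
  set h : ℝ := (u : Matrix (Fin 2) (Fin 2) ℝ) 0 1 with hh
  have hu_eq : u = U h := eq_U U hU u (hD u hu) hu00
  -- the translation parts `T = {x | U x ∈ D}`, an additive subgroup of `ℝ`
  let T : AddSubgroup ℝ :=
    { carrier := {x | U x ∈ D}
      add_mem' := fun {x y} hx hy => by
        change U (x + y) ∈ D
        rw [U_add U hU]
        exact D.mul_mem hx hy
      zero_mem' := by
        change U 0 ∈ D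
        rw [U_zero U hU]
        exact D.one_mem
      neg_mem' := fun {x} hx => by
        change U (-x) ∈ D
        rw [U_neg U hU]
        exact D.inv_mem hx }
  have hTmem : ∀ x, x ∈ T ↔ U x ∈ D := fun x => Iff.rfl
  have hhT : h ∈ T := by rw [hTmem, ← hu_eq]; exact hu
  -- `T` is not dense (discreteness of `D`), hence cyclic
  have hnd : ¬ Dense (T : Set ℝ) := by
    intro hdense
    have hO : {x : ℝ | U x ∈ W} ∈ 𝓝 (0 : ℝ) :=
      (U_continuous U hU).continuousAt.preimage_mem_nhds (by rw [U_zero U hU]; exact hWo.mem_nhds h1W)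
    obtain ⟨ε, hε, hball⟩ := Metric.mem_nhds_iff.mp hO
    obtain ⟨x, hxT, hxB, hx0⟩ : ∃ x ∈ (T : Set ℝ), x ∈ Metric.ball (0 : ℝ) ε ∧ x ≠ 0 := by
      have hε2 : (ε / 2 : ℝ) ∈ Metric.ball (0 : ℝ) ε ∩ {y | y ≠ 0} := by
        refine ⟨?_, ?_⟩
        · rw [Metric.mem_ball, Real.dist_eq, sub_zero, abs_of_pos (by positivity)]
          linarith
        · change ε / 2 ≠ 0
          positivity
      obtain ⟨x, hx1, hx2⟩ :=
        hdense.exists_mem_open (Metric.isOpen_ball.inter isOpen_ne) ⟨ε / 2, hε2⟩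
      exact ⟨x, hx1, hx2.1, hx2.2⟩
    have hUx : U x = 1 := hW _ hxT (hball hxB)
    exact hx0 (U_inj U hU (hUx.trans (U_zero U hU).symm))
  obtain ⟨b, hb⟩ : ∃ b, T = AddSubgroup.closure {b} := (AddSubgroup.dense_or_cyclic T).resolve_left hnd
  have hTb : ∀ x, x ∈ T ↔ ∃ n : ℤ, n • b = x := fun x => by
    rw [hb]; exact AddSubgroup.mem_closure_singleton
  -- normalise: a generator `b₀` with `h = M • b₀`, `M : ℕ`, `0 < M`
  obtain ⟨b₀, M, hTb₀, hMpos, hM⟩ :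
      ∃ (b₀ : ℝ) (M : ℕ), (∀ x, x ∈ T ↔ ∃ n : ℤ, n • b₀ = x) ∧ 0 < M ∧ (M : ℤ) • b₀ = h := by
    obtain ⟨m, hm⟩ := (hTb h).mp hhT
    have hm0 : m ≠ 0 := by
      rintro rfl
      rw [zero_zsmul] at hm
      exact hu01 hm.symm
    rcases lt_or_gt_of_ne hm0 with hneg | hpos
    · refine ⟨-b, (-m).toNat, fun x => ?_, by omega, ?_⟩
      · rw [hTb]
        constructor
        · rintro ⟨n, rfl⟩
          exact ⟨-n, by rw [neg_zsmul, zsmul_neg, neg_neg]⟩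
        · rintro ⟨n, rfl⟩
          exact ⟨-n, by rw [neg_zsmul, zsmul_neg]⟩
      · rw [show (((-m).toNat : ℕ) : ℤ) = -m from Int.toNat_of_nonneg (by omega), zsmul_neg, neg_zsmul,
          neg_neg, hm]
    · exact ⟨b, m.toNat, hTb, by omega, by rw [Int.toNat_of_nonneg hpos.le, hm]⟩
  -- multiples of `h` give powers of `u`
  have hzp : ∀ q : ℤ, U (q • h) ∈ Subgroup.zpowers u := by
    intro q
    induction q using Int.induction_on with
    | zero => rw [zero_zsmul, U_zero U hU]; exact one_mem _
    | succ n ih =>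
      rw [add_zsmul, one_zsmul, U_add U hU]
      exact mul_mem ih (by rw [← hu_eq]; exact Subgroup.mem_zpowers u)
    | pred n ih =>
      rw [sub_zsmul, one_zsmul, U_add U hU, U_neg U hU]
      exact mul_mem ih (inv_mem (by rw [← hu_eq]; exact Subgroup.mem_zpowers u))
  -- the representatives `U (r • b₀)`, `0 ≤ r < M`
  have hUmem : ∀ r : Fin M, U (((r : ℕ) : ℤ) • b₀) ∈ D := fun r => by
    rw [← hTmem, hTb₀]; exact ⟨_, rfl⟩
  have hplus : ∀ d ∈ D, (d : Matrix (Fin 2) (Fin 2) ℝ) 0 0 = 1 →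
      ∃ r : Fin M, (U (((r : ℕ) : ℤ) • b₀))⁻¹ * d ∈ Subgroup.zpowers u := by
    intro d hd hd00
    have hdU : d = U ((d : Matrix (Fin 2) (Fin 2) ℝ) 0 1) := eq_U U hU d (hD d hd) hd00
    have hxT : (d : Matrix (Fin 2) (Fin 2) ℝ) 0 1 ∈ T := by rw [hTmem, ← hdU]; exact hd
    obtain ⟨n, hn⟩ := (hTb₀ _).mp hxT
    have hMz : (0 : ℤ) < M := by exact_mod_cast hMpos
    have hr0 : 0 ≤ n % (M : ℤ) := Int.emod_nonneg n hMz.ne'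
    have hrM : n % (M : ℤ) < M := Int.emod_lt_of_pos n hMz
    refine ⟨⟨(n % (M : ℤ)).toNat, by omega⟩, ?_⟩
    have hr : ((((n % (M : ℤ)).toNat : ℕ) : ℤ)) = n % (M : ℤ) := Int.toNat_of_nonneg hr0
    rw [hdU, ← hn, ← U_neg U hU, ← U_add U hU]
    have hcalc : -(((((n % (M : ℤ)).toNat : ℕ) : ℤ)) • b₀) + n • b₀ = (n / (M : ℤ)) • h := by
      rw [hr, ← hM, smul_smul, ← sub_eq_neg_add, ← sub_smul]
      congr 1
      have := Int.emod_add_mul_ediv n (M : ℤ)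
      linarith
    rw [hcalc]
    exact hzp _
  -- a finite family of coset representatives suffices
  suffices hcov : ∃ (ι : Type) (_ : Finite ι) (rep : ι → D),
      ∀ d : D, ∃ i, ((rep i : D) : SL(2, ℝ))⁻¹ * d ∈ Subgroup.zpowers u by
    obtain ⟨ι, _, rep, hrep⟩ := hcov
    haveI : Finite (D ⧸ (Subgroup.zpowers u).subgroupOf D) := by
      refine Finite.of_surjective (fun i => (QuotientGroup.mk (rep i) : D ⧸ _)) fun q => ?_
      obtain ⟨d, rfl⟩ := QuotientGroup.mk_surjective q
      obtain ⟨i, hi⟩ := hrep d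
      refine ⟨i, QuotientGroup.eq.mpr ?_⟩
      rw [Subgroup.mem_subgroupOf, Subgroup.coe_mul, Subgroup.coe_inv]
      exact hi
    exact Subgroup.finiteIndex_of_finite_quotient
  by_cases hneg : ∃ d₁ ∈ D, (d₁ : Matrix (Fin 2) (Fin 2) ℝ) 0 0 = -1
  · obtain ⟨d₁, hd₁, hd₁00⟩ := hneg
    have hd₁11 : (d₁ : Matrix (Fin 2) (Fin 2) ℝ) 1 1 = -1 := by
      have := mul_eq_one_of_upper d₁ (hD d₁ hd₁)
      rw [hd₁00] at this
      linarith
    refine ⟨Fin M ⊕ Fin M, inferInstance,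
      Sum.elim (fun r => ⟨U (((r : ℕ) : ℤ) • b₀), hUmem r⟩)
        (fun r => ⟨d₁ * U (((r : ℕ) : ℤ) • b₀), D.mul_mem hd₁ (hUmem r)⟩), fun d => ?_⟩
    rcases entry_eq_one_or_neg_one_aux U hU D hD hu hu00 hu01 d.2 with h1 | h1
    · obtain ⟨r, hr⟩ := hplus d d.2 h1
      exact ⟨Sum.inl r, hr⟩
    · have h1' : (((d₁⁻¹ * d : SL(2, ℝ))) : Matrix (Fin 2) (Fin 2) ℝ) 0 0 = 1 := by
        rw [Matrix.SpecialLinearGroup.coe_mul, Matrix.SpecialLinearGroup.coe_inv,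
          Matrix.adjugate_fin_two, Matrix.mul_apply, Fin.sum_univ_two]
        simp only [Matrix.of_apply, Matrix.cons_val', Matrix.cons_val_zero, Matrix.cons_val_one,
          Matrix.cons_val_fin_one]
        rw [hD d d.2, hd₁11, h1]
        ring
      obtain ⟨r, hr⟩ := hplus (d₁⁻¹ * d) (D.mul_mem (D.inv_mem hd₁) d.2) h1'
      refine ⟨Sum.inr r, ?_⟩
      change (d₁ * U (((r : ℕ) : ℤ) • b₀))⁻¹ * (d : SL(2, ℝ)) ∈ Subgroup.zpowers u
      rwa [mul_inv_rev, mul_assoc]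
  · push Not at hneg
    refine ⟨Fin M, inferInstance, fun r => ⟨U (((r : ℕ) : ℤ) • b₀), hUmem r⟩, fun d => ?_⟩
    have h1 : (d : Matrix (Fin 2) (Fin 2) ℝ) 0 0 = 1 :=
      (entry_eq_one_or_neg_one_aux U hU D hD hu hu00 hu01 d.2).resolve_right (hneg d d.2)
    obtain ⟨r, hr⟩ := hplus d d.2 h1
    exact ⟨r, hr⟩

end Unipotent

/-- **Diagonal entries are `±1`**: in a DISCRETE upper-triangular subgroup `D ≤ SL(2, ℝ)` (all
`d₁₀ = 0`) containing a unipotent `u` (`u₀₀ = 1`, `u₀₁ ≠ 0`), every element has diagonal `(±1, ±1)` —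
i.e. `D` consists of `±`(translations): a discrete group fixing a cusp of one of its parabolic elements
contains no hyperbolic element with that fixed point. [cite: FarkasKra1992, IV.5.6]
[cite: MochizukiAbsTopIII2015, Proposition 4.2 (i) proof p.106] -/
theorem sl_entry_eq_one_or_neg_one_of_upperTriangular_discrete (D : Subgroup SL(2, ℝ))
    [DiscreteTopology D] (hD : ∀ d ∈ D, (d : Matrix (Fin 2) (Fin 2) ℝ) 1 0 = 0) {u : SL(2, ℝ)}
    (hu : u ∈ D) (hu00 : (u : Matrix (Fin 2) (Fin 2) ℝ) 0 0 = 1)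
    (hu01 : (u : Matrix (Fin 2) (Fin 2) ℝ) 0 1 ≠ 0) {d : SL(2, ℝ)} (hd : d ∈ D) :
    (d : Matrix (Fin 2) (Fin 2) ℝ) 0 0 = 1 ∨ (d : Matrix (Fin 2) (Fin 2) ℝ) 0 0 = -1 :=
  entry_eq_one_or_neg_one_aux (fun x => ⟨!![1, x; 0, 1], by simp [Matrix.det_fin_two_of]⟩)
    (fun _ => rfl) D hD hu hu00 hu01 hd

/-- **Finite index over a unipotent element**: in a DISCRETE upper-triangular subgroup
`D ≤ SL(2, ℝ)` containing a unipotent `u` (`u₀₀ = 1`, `u₀₁ ≠ 0`), the cyclic group `⟨u⟩` has finite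
index — the translation parts `{x | [[1, x], [0, 1]] ∈ D}` form a discrete, hence cyclic, subgroup
`ℤ b₀` of `ℝ` containing `u₀₁ = M b₀`, and `D ⊆ {±1} · U(ℤ b₀)`, so at most `2M` cosets.
[cite: FarkasKra1992, IV.5.6] [cite: MochizukiAbsTopIII2015, Proposition 4.2 (i) proof p.106] -/
theorem finiteIndex_zpowers_of_upperTriangular_discrete (D : Subgroup SL(2, ℝ))
    [DiscreteTopology D] (hD : ∀ d ∈ D, (d : Matrix (Fin 2) (Fin 2) ℝ) 1 0 = 0) {u : SL(2, ℝ)}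
    (hu : u ∈ D) (hu00 : (u : Matrix (Fin 2) (Fin 2) ℝ) 0 0 = 1)
    (hu01 : (u : Matrix (Fin 2) (Fin 2) ℝ) 0 1 ≠ 0) :
    ((Subgroup.zpowers u).subgroupOf D).FiniteIndex :=
  finiteIndex_zpowers_aux (fun x => ⟨!![1, x; 0, 1], by simp [Matrix.det_fin_two_of]⟩)
    (fun _ => rfl) D hD hu hu00 hu01

/-- **Finite index over a parabolic element**: in a DISCRETE upper-triangular subgroup
`D ≤ SL(2, ℝ)` containing a PARABOLIC `u` (Mathlib's `Matrix.IsParabolic`: non-scalar with vanishing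
discriminant, i.e. here `u₀₀ = u₁₁ = ±1`, `u₀₁ ≠ 0`), `⟨u⟩` has finite index (apply the unipotent
case to `u²`). [cite: FarkasKra1992, IV.5.6] [cite: MochizukiAbsTopIII2015, Proposition 4.2 (i) proof p.106] -/
theorem finiteIndex_zpowers_of_upperTriangular_discrete_of_isParabolic (D : Subgroup SL(2, ℝ))
    [DiscreteTopology D] (hD : ∀ d ∈ D, (d : Matrix (Fin 2) (Fin 2) ℝ) 1 0 = 0) {u : SL(2, ℝ)}
    (hu : u ∈ D) (hpar : (u : Matrix (Fin 2) (Fin 2) ℝ).IsParabolic) :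
    ((Subgroup.zpowers u).subgroupOf D).FiniteIndex := by
  have h10 := hD u hu
  obtain ⟨h0011, h01⟩ := (Matrix.isParabolic_iff_of_upperTriangular h10).mp hpar
  have hdet := mul_eq_one_of_upper u h10
  have h00ne : (u : Matrix (Fin 2) (Fin 2) ℝ) 0 0 ≠ 0 := fun h0 => by
    rw [h0, zero_mul] at hdet
    exact zero_ne_one hdet
  have hsq : ((u ^ 2 : SL(2, ℝ)) : Matrix (Fin 2) (Fin 2) ℝ) =
      (u : Matrix (Fin 2) (Fin 2) ℝ) * (u : Matrix (Fin 2) (Fin 2) ℝ) := by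
    rw [pow_two, Matrix.SpecialLinearGroup.coe_mul]
  have hsq00 : ((u ^ 2 : SL(2, ℝ)) : Matrix (Fin 2) (Fin 2) ℝ) 0 0 = 1 := by
    rw [hsq, Matrix.mul_apply, Fin.sum_univ_two, h10, mul_zero, add_zero]
    nth_rewrite 2 [h0011]
    exact hdet
  have hsq01 : ((u ^ 2 : SL(2, ℝ)) : Matrix (Fin 2) (Fin 2) ℝ) 0 1 ≠ 0 := by
    rw [hsq, Matrix.mul_apply, Fin.sum_univ_two, ← h0011]
    intro h
    have : (u : Matrix (Fin 2) (Fin 2) ℝ) 0 1 * (2 * (u : Matrix (Fin 2) (Fin 2) ℝ) 0 0) = 0 := by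
      linarith
    rcases mul_eq_zero.mp this with h' | h'
    · exact h01 h'
    · exact h00ne (by linarith)
  haveI := finiteIndex_zpowers_of_upperTriangular_discrete D hD (D.pow_mem hu 2) hsq00 hsq01
  refine Subgroup.finiteIndex_of_le (H := (Subgroup.zpowers (u ^ 2)).subgroupOf D) fun x hx => ?_
  rw [Subgroup.mem_subgroupOf] at hx ⊢
  exact (Subgroup.zpowers_le.mpr ((Subgroup.zpowers u).pow_mem (Subgroup.mem_zpowers u) 2)) hx

end Literature.AnabelianGeometry.AbsoluteAnabelian.HolRS

end
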